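import Mathlib
import Summits.AtomisticToContinuum.Crystallization.Theorems.ThreeConeCertificateExactCertificateTransfer1DMinGap

/-!
# Crux `ExactCertificate` (stmt-AtomisticToContinuum-11959), line `closure-makes-nogap-exact`,
# Transfer skeleton IV `SlackRigidity1D` — stub `stub_siteEnergyHalf`: site energy `≥ 1/2` of a crowded particle

Support file (`--supports stmt-AtomisticToContinuum-11959`) for the crux
`Summit.AtomisticToContinuum.Crystallization.Theses.ThreeConeCertificate.ExactCertificate`, line
`closure-makes-nogap-exact`, Transfer skeleton IV `SlackRigidity1D` (slack rigidity of the Lennard-Jones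
CHAIN: the route decl `SlackRigidity` with `3 ↦ 1`, verbatim otherwise).  Nothing in this file closes the
3-D crux.

Step 1 of the skeleton (CROWDING SURGERY) deletes the left particle `i₀` of a closest pair of the sorted
positions `y : ℕ → ℝ` on `range N` while its gap `δ = y (i₀+1) − y i₀` is `< 3/4`; to bound the number of
deletions by the slack it needs the QUANTITATIVE version of `minGap_siteEnergy_pos`
(file `…Transfer1DMinGap.lean`, conclusion `0 < …`): the site energy
`∑_{i₀<j<N} V(|y j − y i₀|) + ∑_{p<i₀} V(|y i₀ − y p|)`, `V = lennardJones`, of the deleted particle is `≥ 1/2`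
(`stub_siteEnergyHalf`).

Mechanism (the estimate of `minGap_siteEnergy_pos`, with sharper closing numerics).  All gaps are `≥ δ`, so
`|y k − y i₀| ≥ |k − i₀| δ` (`minGap_le_sub`); with `V(r) ≥ −r⁻⁶/6` (`neg_le_lennardJones_of_le`), the
closest right neighbour counted exactly, the tail bound `∑_{m ≥ 2} m⁻⁶ ≤ 1/8` (`minGap_sum_inv_pow_six_tail`)
for the other right neighbours and `∑_{m ≥ 1} m⁻⁶ ≤ 9/8` (`minGap_sum_inv_pow_six`) for the left ones, the site
energy is `≥ u²/12 − 3u/8` with `u = δ⁻⁶` (`slackSite_siteEnergy_ge`).  For `δ < 3/4`,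
`u > (4/3)⁶ = u₀ = 4096/729`, and `u² − (9/2)u − 6 = (u − u₀)(u + u₀ − 9/2) + (u₀² − (9/2)u₀ − 6)` with
`u₀ > 9/4` and `u₀² − (9/2)u₀ − 6 = 151642/531441 > 0`, so `u²/12 − 3u/8 ≥ 1/2` (`slackSite_poly`).
-/

noncomputable section

namespace Summit.AtomisticToContinuum.Crystallization.Theorems.ThreeConeCertificateExactCertificate.Transfer1D

open Literature.MathematicalPhysics.StatisticalMechanics
open scoped BigOperators

/-! ## Closing numerics -/

/-- `1/2 ≤ u²/12 − 3u/8` as soon as `u > 4096/729 = (4/3)⁶`: indeed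
`u² − (9/2)u − 6 = (u − u₀)(u + u₀ − 9/2) + (u₀² − (9/2)u₀ − 6)` with `u₀ = 4096/729 > 9/4` and
`u₀² − (9/2)u₀ − 6 = 151642/531441 > 0`. [folklore] -/
theorem slackSite_poly {u : ℝ} (hu : (4096 : ℝ) / 729 < u) :
    1 / 2 ≤ (1 / 12) * u ^ 2 - (3 / 8) * u := by
  nlinarith [mul_pos (sub_pos.2 hu) (show (0 : ℝ) < u + 4096 / 729 - 9 / 2 by linarith)]

/-! ## The site energy of a crowded particle, quantitatively -/

/-- If all nearest-neighbour gaps of a configuration `y` on `range N` are `≥ δ = y (i₀+1) − y i₀ > 0`, then the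
site energy of particle `i₀`, `∑_{i₀<j<N} V(|y j − y i₀|) + ∑_{p<i₀} V(|y i₀ − y p|)`, is
`≥ δ⁻¹²/12 − (3/8)δ⁻⁶`: the closest right neighbour contributes `V(δ) = δ⁻¹²/12 − δ⁻⁶/6` exactly, the other
right neighbours `≥ −(δ⁻⁶/6)·(1/8)` and the left neighbours `≥ −(δ⁻⁶/6)·(9/8)` (`V(r) ≥ −r⁻⁶/6`,
`|y k − y i₀| ≥ |k − i₀| δ`, tail and partial sums of `ζ(6)`). [folklore] -/
theorem slackSite_siteEnergy_ge {N i₀ : ℕ} {y : ℕ → ℝ} {δ : ℝ} (hi₀ : i₀ + 1 < N)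
    (hδ : y (i₀ + 1) - y i₀ = δ) (hδpos : 0 < δ)
    (hgap : ∀ k, k + 1 < N → δ ≤ y (k + 1) - y k) :
    (1 / 12) * ((δ⁻¹) ^ 6) ^ 2 - (3 / 8) * (δ⁻¹) ^ 6 ≤
      ∑ j ∈ Finset.Ico (i₀ + 1) N, lennardJones (|y j - y i₀|) +
        ∑ p ∈ Finset.range i₀, lennardJones (|y i₀ - y p|) := by
  have htel := minGap_le_sub hgap
  -- right neighbours: the closest one exactly, the others through the attractive tail
  have hR : (1 / 12) * (δ⁻¹) ^ 12 - (1 / 6) * (δ⁻¹) ^ 6 - (1 / 6) * (δ⁻¹) ^ 6 * (1 / 8) ≤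
      ∑ j ∈ Finset.Ico (i₀ + 1) N, lennardJones (|y j - y i₀|) := by
    rw [Finset.sum_Ico_eq_sum_range]
    obtain ⟨n, hn⟩ : ∃ n, N - (i₀ + 1) = n + 1 := ⟨N - (i₀ + 1) - 1, by omega⟩
    rw [hn, Finset.sum_range_succ', add_zero, hδ, abs_of_pos hδpos]
    have h0 : lennardJones δ = (1 / 12) * (δ⁻¹) ^ 12 - (1 / 6) * (δ⁻¹) ^ 6 := rfl
    have hk : ∀ k ∈ Finset.range n, -((1 / 6) * (δ⁻¹) ^ 6 * (((k : ℝ) + 2)⁻¹) ^ 6) ≤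
        lennardJones (|y (i₀ + 1 + (k + 1)) - y i₀|) := by
      intro k hk
      rw [Finset.mem_range] at hk
      have h := htel (k + 2) i₀ (by omega)
      rw [show i₀ + 1 + (k + 1) = i₀ + (k + 2) by omega]
      push_cast at h
      have hpos : (0 : ℝ) < ((k : ℝ) + 2) * δ := by positivity
      have hb := neg_le_lennardJones_of_le hpos (h.trans (le_abs_self _))
      rw [mul_inv, mul_pow] at hb
      linarith
    have htail : -((1 / 6) * (δ⁻¹) ^ 6 * (1 / 8)) ≤
        ∑ k ∈ Finset.range n, lennardJones (|y (i₀ + 1 + (k + 1)) - y i₀|) :=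
      calc -((1 / 6) * (δ⁻¹) ^ 6 * (1 / 8))
          ≤ -((1 / 6) * (δ⁻¹) ^ 6 * ∑ k ∈ Finset.range n, (((k : ℝ) + 2)⁻¹) ^ 6) := by
            have hs := minGap_sum_inv_pow_six_tail n
            have h6 : (0 : ℝ) ≤ (1 / 6) * (δ⁻¹) ^ 6 := by positivity
            linarith [mul_le_mul_of_nonneg_left hs h6]
        _ = ∑ k ∈ Finset.range n, -((1 / 6) * (δ⁻¹) ^ 6 * (((k : ℝ) + 2)⁻¹) ^ 6) := by
            rw [Finset.mul_sum, Finset.sum_neg_distrib]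
        _ ≤ _ := Finset.sum_le_sum hk
    linarith
  -- left neighbours: all through the attractive tail
  have hL : -((1 / 6) * (δ⁻¹) ^ 6 * (9 / 8)) ≤
      ∑ p ∈ Finset.range i₀, lennardJones (|y i₀ - y p|) := by
    rw [← Finset.sum_range_reflect (fun p => lennardJones (|y i₀ - y p|)) i₀]
    have hk : ∀ k ∈ Finset.range i₀, -((1 / 6) * (δ⁻¹) ^ 6 * (((k : ℝ) + 1)⁻¹) ^ 6) ≤
        lennardJones (|y i₀ - y (i₀ - 1 - k)|) := by
      intro k hk
      rw [Finset.mem_range] at hk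
      have h := htel (k + 1) (i₀ - 1 - k) (by omega)
      rw [show i₀ - 1 - k + (k + 1) = i₀ by omega] at h
      push_cast at h
      have hpos : (0 : ℝ) < ((k : ℝ) + 1) * δ := by positivity
      have hb := neg_le_lennardJones_of_le hpos (h.trans (le_abs_self _))
      rw [mul_inv, mul_pow] at hb
      linarith
    calc -((1 / 6) * (δ⁻¹) ^ 6 * (9 / 8))
        ≤ -((1 / 6) * (δ⁻¹) ^ 6 * ∑ k ∈ Finset.range i₀, (((k : ℝ) + 1)⁻¹) ^ 6) := by
          have hs := minGap_sum_inv_pow_six i₀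
          have h6 : (0 : ℝ) ≤ (1 / 6) * (δ⁻¹) ^ 6 := by positivity
          linarith [mul_le_mul_of_nonneg_left hs h6]
      _ = ∑ k ∈ Finset.range i₀, -((1 / 6) * (δ⁻¹) ^ 6 * (((k : ℝ) + 1)⁻¹) ^ 6) := by
          rw [Finset.mul_sum, Finset.sum_neg_distrib]
      _ ≤ _ := Finset.sum_le_sum hk
  -- assemble: `u²/12 − u/6 − u/48 − 9u/48 = u²/12 − 3u/8`, `u = δ⁻⁶`
  have h12 : (δ⁻¹) ^ 12 = ((δ⁻¹) ^ 6) ^ 2 := by ring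
  rw [h12] at hR
  linarith

/-! ## The stub -/

/-- STUB (A2) `stub_siteEnergyHalf` — QUANTITATIVE CROWDING: if the smallest nearest-neighbour gap
`δ = y (i₀+1) − y i₀` of a configuration on `range N` all of whose gaps are `≥ δ` is `< 3/4`, the site energy of
particle `i₀` is `≥ 1/2` (`≥ δ⁻¹²/12 − (3/8)δ⁻⁶` by `slackSite_siteEnergy_ge`, and `δ⁻⁶ > (4/3)⁶ = 4096/729`,
where `u²/12 − 3u/8 ≥ 1/2` by `slackSite_poly`; `minGap_siteEnergy_pos` proves `> 0` by the same estimate).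
[folklore] -/
theorem stub_siteEnergyHalf : ∀ (N i₀ : ℕ) (y : ℕ → ℝ) (δ : ℝ), i₀ + 1 < N → y (i₀ + 1) - y i₀ = δ →
    0 < δ → δ < 3 / 4 →
    (∀ k : ℕ, k + 1 < N → δ ≤ y (k + 1) - y k) →
    1 / 2 ≤ ∑ j ∈ Finset.Ico (i₀ + 1) N, lennardJones (|y j - y i₀|) +
      ∑ p ∈ Finset.range i₀, lennardJones (|y i₀ - y p|) := by
  intro N i₀ y δ hi₀ hδ hδpos hδlt hgap
  have hE := slackSite_siteEnergy_ge hi₀ hδ hδpos hgap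
  -- numerics: `u = δ⁻⁶ > (4/3)⁶ = 4096/729`
  have hδinv : (4 : ℝ) / 3 < δ⁻¹ := by
    rw [show (4 : ℝ) / 3 = (3 / 4)⁻¹ by norm_num]
    exact (inv_lt_inv₀ (by norm_num) hδpos).2 hδlt
  have h6 : ((4 : ℝ) / 3) ^ 6 < (δ⁻¹) ^ 6 := pow_lt_pow_left₀ hδinv (by norm_num) (by norm_num)
  have hu : (4096 : ℝ) / 729 < (δ⁻¹) ^ 6 := lt_of_eq_of_lt (by norm_num) h6
  exact (slackSite_poly hu).trans hE

end Summit.AtomisticToContinuum.Crystallization.Theorems.ThreeConeCertificateExactCertificate.Transfer1D
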